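import Summits.ABC.ABC.Theorems.CongruentialReceptacleAssembly

/-!
# Sketch (crux-ideate k=2, round 1) — CompactBalanceTransfer (stmt-ABC-1725)

Two checkable facts recorded for triage / the tenure planner:

1. HARDNESS CERTIFICATE. The crux `CompactBalanceTransfer` (balanced abc for every κ → ABC) already
   contains the classical open implication "Szpiro (6+ε) for all Frey curves ⟹ abc (1+ε)":
   `crux_gives_szpiro_to_abc : CompactBalanceTransfer → FreySzpiroAll → ABC`, because Szpiro for all
   Frey curves trivially gives the route Target `BalancedFreySzpiro` and the route's proved `Assembly`
   (Theorems/CongruentialReceptacleAssembly.lean) does the rest. (Plain Szpiro is only known to give abc-exponent 3/2; Vojta 1987 App. ABC.)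

2. RESTATEMENT CANDIDATE (planner's call, documented fallback of the route header): the bounded-degree
   balanced hypothesis that Mochizuki's GenEll Thm 2.1 architecture (Kummer/Fermat or full-level lift of
   degree ≤ d(ε), Vojta_∅ on a compact curve, noncritical Belyi maps) actually consumes, typed in the
   tree's uniform-abc currency (`Height.mulHeight`, `radicalNorm`, `NumberField.discr`), with compact
   balance demanded at EVERY complex embedding.
-/

set_option linter.dupNamespace false

namespace Summit.ABC.ABC.Cruxes.CompactBalanceTransfer.Ideator2

open Summit.ABC.ABC.Theses.CongruentialReceptacle
open Literature.NumberTheory.DiophantineGeometry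

/-- Szpiro's conjecture with exponent `6 + ε` for ALL Frey curves `E_{a,b}`, in the route's elementary
currency (`2⁸Δ_min = (abc)²`, `N = rad(abc)` under Serre's normalisation). -/
def FreySzpiroAll : Prop :=
  ∀ ε : ℝ, 0 < ε → ∃ C : ℝ, ∀ a b c : ℕ, IsABCTriple a b c →
    ((a * b * c : ℕ) : ℝ) ^ 2 ≤ C * ((rad a b c : ℕ) : ℝ) ^ (6 + ε)

/-- Szpiro for all Frey curves trivially implies the route Target (Szpiro on the balanced cell). -/
theorem freySzpiroAll_balanced (h : FreySzpiroAll) : BalancedFreySzpiro := by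
  intro κ _hκ ε hε
  obtain ⟨C, hC⟩ := h ε hε
  exact ⟨C, fun a b c habc _ _ => hC a b c habc⟩

/-- HARDNESS CERTIFICATE: any proof of the crux proves "Szpiro_Frey ⟹ abc". -/
theorem crux_gives_szpiro_to_abc (hT : CompactBalanceTransfer) : FreySzpiroAll → _root_.ABC :=
  fun h => Summit.ABC.ABC.Theorems.congruentialReceptacle_assembly_proof (freySzpiroAll_balanced h) hT

/-- Balanced UNIFORM abc over number fields of degree `≤ d` (Granville–Stark / Masser shape, exponent
`1 + ε` on `|D_K| · N_K`, constant `C ^ [K:ℚ]`), restricted to projective points `(a : b : c)`,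
`a + b = c`, that are `κ`-compactly-balanced at EVERY complex embedding. For `d = 1` this is (up to the
normalisation `mulHeight ![a,b,c] = c`, `discr ℚ = 1`, `radicalNorm = rad`) the hypothesis of
`CompactBalanceTransfer`. -/
def UniformBalancedABC (d : ℕ) : Prop :=
  ∀ κ : ℝ, 0 < κ → ∀ ε : ℝ, 0 < ε → ∃ C : ℝ, ∀ (K : Type) [Field K] [NumberField K] (a b c : K),
    Module.finrank ℚ K ≤ d → a ≠ 0 → b ≠ 0 → c ≠ 0 → a + b = c →
    (∀ σ : K →+* ℂ, κ * ‖σ c‖ ≤ ‖σ a‖ ∧ κ * ‖σ c‖ ≤ ‖σ b‖) →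
      Height.mulHeight ![a, b, c] <
        C ^ Module.finrank ℚ K *
          ((|NumberField.discr K| : ℝ) * (radicalNorm a b c : ℝ)) ^ (1 + ε)

/-- RESTATEMENT CANDIDATE for the rank-4 crux (tenure planner's call): compactly-balanced uniform abc in
EVERY bounded degree implies abc. This is the over-ℚ conclusion of the GenEll Thm 2.1 architecture
(degree `d(ε) ≍ (3/ε)²` via the Fermat curve `F_e`, `e > 3/ε`, or `|GL₂(ℤ/2n)|` via `X(2n)`), a
refereed, IUT-free argument [MochizukiGenEll2010 Thm 2.1; Elkies1991ABCMordell; Vojta1987 §5]. -/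
def KummerBalanceTransfer : Prop :=
  (∀ d : ℕ, UniformBalancedABC d) → _root_.ABC

/-- Sanity: the bounded-degree transfer is implied by the filed crux together with the (d = 1)
specialisation lemma `h1`; stated with `h1` as a hypothesis because the normalisation
`mulHeight ![a,b,c] = c` for coprime naturals is bookkeeping left to a prover. -/
theorem kummerBalanceTransfer_of_crux
    (h1 : UniformBalancedABC 1 →
      (∀ κ : ℝ, 0 < κ → ∀ ε : ℝ, 0 < ε → ∃ C : ℝ, ∀ a b c : ℕ, IsABCTriple a b c →
        κ * (c : ℝ) ≤ (a : ℝ) → κ * (c : ℝ) ≤ (b : ℝ) → (c : ℝ) < C * ((rad a b c : ℕ) : ℝ) ^ (1 + ε)))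
    (hT : CompactBalanceTransfer) : KummerBalanceTransfer :=
  fun hd => hT (h1 (hd 1))

end Summit.ABC.ABC.Cruxes.CompactBalanceTransfer.Ideator2
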